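import Summits.BirchSwinnertonDyer.BirchSwinnertonDyer.Theorems.QuadraticBranchSignedControlPlusEtaNonsurjMuBound
import Summits.BirchSwinnertonDyer.Rank1Residual.O6.X4CongruenceAnchor
import HarnessLib

/-!
# Route `QuadraticBranchSignedControl` (rung K8, cell `bsd-potss`), residual crux
# `PlusEtaMainConjectureNonsurj` (stmt-BirchSwinnertonDyer-19606): the CONGRUENT-ANCHOR ROAD for
# `stub_etaMC_r0_mu` — `μ(X⁺(V/K_∞)^η) = 0` transported along `V[p] ≅ V′[p]` (Hatley–Lei 2019, Thm. 4.6,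
# DISPLAYED) from an anchor `V′` where it is known (seat `bsd-potss-k8eta-c2` g3, file 4)

WHAT. Crux 19606's rank-`0` sub-cut (skeleton v3) has open content on the 7 Tamagawa-`5` rows of the
census (78300bh1, 159300l1, 162675n1, 404325f1, 164700i1, 164700n1, 417600fp1): `μ(X⁺(V/K_∞)^η) = 0`
(`stub_etaMC_r0_mu`). Hatley–Lei, *Arithmetic properties of signed Selmer groups at non-ordinary primes*,
Ann. Inst. Fourier 69 (2019) 1259–1294 (arXiv:1608.00257), **Thm. 4.6**: for congruent non-ordinary
newforms `f`, `g` (`T_f/ϖ ≅ T_g/ϖ` as `G_ℚ`-modules, hypotheses (irred), (inv), (tor), (BLZ)) and ANY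
character `θ` of `Δ = Gal(ℚ(μ_p)/ℚ)`: "the `μ`-invariant of `Sel_i(A_{f,s}/ℚ(μ_{p^∞}))^θ` vanishes if and
only if that of `Sel_i(A_{g,s}/ℚ(μ_{p^∞}))^θ` vanishes" — the `μ`-TRANSFER ON EVERY `Δ`-ISOTYPIC
COMPONENT, in particular at `θ = η = ω^{(p−1)/2}` (seat g2's presearch had found only the trivial
component, B. D. Kim 2009). For elliptic curves `V`, `V′` good supersingular at `p ≥ 5` with
`a_p = 0` the hypotheses read: `V[p]` irreducible (irred); `k = 2 ≤ p` (inv); `a_p = 0` (tor, Kobayashi);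
`a_p = 0` (BLZ); `V[p] ≅ V′[p]` (Cong) — and Lei–Loeffler–Zerbes' `Sel_2` IS Kobayashi's `Sel⁺` when
`a_p = 0`. CENSUS (this seat, kit j269291/j269913/j270007, certificate j270119 = Kraus–Oesterlé 1992
Prop. 4 with ALL primes `ℓ ≤ μ(M)/6`): every non-CM rank-`0` row of 19606 below `5·10⁵` is congruent
mod `5` to a CM curve of the census (`j = 0`, CM by `ℚ(√−3)` — the quadratic field of its `C_ns⁺(5)`
image): the 5 unit rows to CM UNIT rows (900b1, 3600bb1, 10800cj1, 14400cz1), the 7 Tamagawa rows to the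
RANK-ONE CM curves 2700p1 (78300bh1, 159300l1, 164700i1, 164700n1), 675a1 (162675n1, 404325f1),
14400l1 (417600fp1) — single-prime level raisings at `ℓ ∈ {29, 59, 61, 241, 599}` with `5 ∣ c_ℓ`.

THIS FILE types the road, with the transfer DISPLAYED as a hypothesis `hHL` spelled out on the tree's
objects (no `def`, no Literature fact minted here — a typer files Hatley–Lei Thm. 4.6 + LLZ10 §5 as a
named fact; then `hHL` is discharged by name):

* §1 `etaMu_of_modPCongruent` — `hHL` + `ModPCongruent V′ V p` + «`μ = 0` for every `η`-datum of `V′`»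
  ⟹ «`μ = 0` for every `η`-datum of `V`» (= `stub_etaMC_r0_mu`'s conclusion `EtaMuZeroAt V p`);
  `etaMu_of_modPCongruent_unitRow` — the anchor discharged by a UNIT row (`Sel_{p^∞}(W′/ℚ) = 0`,
  `p ∤ Tam(W′)`: seat g2's `EtaMuBound.eta_hasUnitContent_of_selmer_trivial_of_not_dvd_tamagawa`).
* §2 `quadraticBranchPlusEtaMainConjectureAt_of_modPCongruent_of_missingLowerBoundAt` — composed with
  seat g2's `μ`-road (`EtaMuSaturation…`, over ctrl g4's converse road): on a rank-`0` row,
  **(C1⁺_η)(V,p) ⟸ `hHL` + a congruent anchor with `μ = 0` + the lower half of `BSD_p(W)` + named facts**.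
  For the 7 Tamagawa rows the anchors are the three rank-ONE CM pairs above, whose `μ = 0` is the CM
  stub's business (`stub_etaMC_cm`: Pollack–Rubin at `η` gives `Char = (L_p⁺(V′,η,X))`, and
  `μ(L_p⁺(V′,η,X)) = 0` is one unit coefficient — PARI: `(λ,μ) = (1,0), (5,0), (1,0)`): **the non-CM
  rank-`0` residual of 19606 is ABSORBED by the CM stub modulo Hatley–Lei Thm. 4.6.**

HONEST FRAMING (cell `bsd-potss`, run/shared/lean/pub/bsd-potss/; FULL-BSD rank ≤ 1 programme,
tranche 1b, HUMAN RULING D-0036/D-0074): BOOKKEEPING THEOREMS ONLY — no definition, no named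
Literature fact minted, no Summits-side `def … : Prop`, no `sorry`, axioms standard. CONDITIONAL on the
DISPLAYED transfer `hHL` (in print: Hatley–Lei 2019 Thm. 4.6 with LLZ10's identification `Sel_2 = Sel⁺`;
NOT yet a tree fact), on the displayed anchor data, and in §2 on Poitou–Tate, modularity, GZK,
Kobayashi Thm. 2.2 / 4.1 (rational clause) at `η`, Kitajima–Otsuki at `η` (named facts). The
congruences themselves are per-row INPUTS (`ModPCongruent`, certified numerically by Kraus–Oesterlé
Prop. 4, kit j270119 — not kernel-checked). Nothing is proved by name; the crux 19606 stays OPEN;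
nothing is booked; no label / mark / count moves. `--supports stmt-BirchSwinnertonDyer-19606`.

References: [HatleyLei2019] J. Hatley, A. Lei, Ann. Inst. Fourier 69 (2019) 1259–1294, Thm. 4.6, §2.1
(Sel_i over ℚ(μ_{p^∞}) and its Δ-components), §7 (hypotheses table); [LeiLoefflerZerbes2010] §5
(Sel_1/Sel_2 = Kobayashi's Sel^∓ for a_p = 0); [Kobayashi2003] §4 p. 8; [GreenbergVatsal2000] p. 2 (2);
[KrausOesterle1992] Prop. 4; [PollackRubin2004] Theorem and remark p. 448; [BDKim2009] Cor. 2.13.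
-/

set_option autoImplicit false
set_option linter.dupNamespace false

noncomputable section

open scoped Classical

open CongruenceSubgroup Field Function NumberField IsDedekindDomain WeierstrassCurve
open Literature.NumberTheory.EllipticCurves
open Literature.NumberTheory.EllipticCurves.ModularForms
open Literature.NumberTheory.EllipticCurves.Rank1Residual
open Literature.NumberTheory.EllipticCurves.Rank1Residual.Typed
open Literature.NumberTheory.GaloisRepresentations
open Literature.NumberTheory.GaloisCohomology
open Literature.NumberTheory.EllipticCurves.IwasawaAlgebra
open Literature.NumberTheory.EllipticCurves.IwasawaDual ZpExtension
open Literature.NumberTheory.EllipticCurves.GreenbergVatsal2000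
open Summit.BirchSwinnertonDyer.Rank1Residual.X11b.Levels
open Summit.BirchSwinnertonDyer.Rank1Residual.X11b
open Summit.BirchSwinnertonDyer.Rank1Residual.Additive
open Summit.BirchSwinnertonDyer.Rank1Residual.Additive.SignedTwist
open scoped ContRepresentation
open Summit.BirchSwinnertonDyer.Rank1Residual.AdditivePotMult
open Summit.BirchSwinnertonDyer.Rank1Residual.O6 (ModPCongruent)

namespace Summit.BirchSwinnertonDyer.BirchSwinnertonDyer.Theorems

namespace EtaCongruentAnchor

variable (p : ℕ) [hp : Fact p.Prime]

/-! ## §1 The transfer, displayed, and the anchor -/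

/-- **`μ(X⁺(V/K_∞)^η) = 0` from a congruent anchor** — the shape of Hatley–Lei's Thm. 4.6 at
`θ = η` on the tree's objects, DISPLAYED as the hypothesis `hHL`: for good supersingular `a_p = 0`
curves `V′`, `V` at `p ≥ 5` with `V′[p] ≅ V[p]` (`ModPCongruent V′ V p`, `Γ_ℚ`-equivariantly), if every
`η`-signed plus dual datum of `V′` has a characteristic generator of unit content then so does every
`η`-datum of `V`. With an anchor `V′` where `μ = 0` is known, the conclusion is verbatim `EtaMuZeroAt V p`
of skeleton v3's `stub_etaMC_r0_mu`. Pure modus ponens; CONDITIONAL on `hHL` (in print, not a tree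
fact) and the anchor. [cite: HatleyLei2019, Thm. 4.6 and §2.1 (Δ-isotypic components over ℚ(μ_{p^∞}))]
[cite: LeiLoefflerZerbes2010, §5 (Sel_2 = Sel⁺ when a_p = 0)] [cite: GreenbergVatsal2000, p. 2 (2)] -/
theorem etaMu_of_modPCongruent
    (hHL : ∀ (V' : WeierstrassCurve ℚ) [V'.IsElliptic] [V'.IsGloballyMinimal]
        (V : WeierstrassCurve ℚ) [V.IsElliptic] [V.IsGloballyMinimal],
        5 ≤ p → V'.HasGoodReductionAtPrime p → V'.frobeniusTrace p = 0 →
        V.HasGoodReductionAtPrime p → V.frobeniusTrace p = 0 → ModPCongruent V' V p →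
      (∀ (K₀ : Type) [Field K₀] [NumberField K₀] [IsCyclotomicExtension {p} ℚ K₀]
          [(galRange (K := ℚ) K₀).Normal] (ηq : absoluteGaloisGroup ℚ →* ℤˣ),
          (∀ σ ∈ galRange (K := ℚ) K₀, ηq σ = 1) → ηq ≠ 1 →
        ∀ (κ : ZpExtension ℚ p) (γ : absoluteGaloisGroup ℚ),
          κ.IsCyclotomic → κ.IsTopGenerator γ → γ ∈ galRange (K := ℚ) K₀ →
        ∀ (D : EtaSignedSelmerDualData V' κ K₀ ℚ_[p] ηq γ 1) (g : IwasawaAlgebra p),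
          D.charIdeal = Ideal.span {g} → HasUnitContent g) →
      (∀ (K₀ : Type) [Field K₀] [NumberField K₀] [IsCyclotomicExtension {p} ℚ K₀]
          [(galRange (K := ℚ) K₀).Normal] (ηq : absoluteGaloisGroup ℚ →* ℤˣ),
          (∀ σ ∈ galRange (K := ℚ) K₀, ηq σ = 1) → ηq ≠ 1 →
        ∀ (κ : ZpExtension ℚ p) (γ : absoluteGaloisGroup ℚ),
          κ.IsCyclotomic → κ.IsTopGenerator γ → γ ∈ galRange (K := ℚ) K₀ →
        ∀ (D : EtaSignedSelmerDualData V κ K₀ ℚ_[p] ηq γ 1) (g : IwasawaAlgebra p),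
          D.charIdeal = Ideal.span {g} → HasUnitContent g))
    (V' : WeierstrassCurve ℚ) [V'.IsElliptic] [V'.IsGloballyMinimal]
    (V : WeierstrassCurve ℚ) [V.IsElliptic] [V.IsGloballyMinimal]
    (hp5 : 5 ≤ p) (hgood' : V'.HasGoodReductionAtPrime p) (hap' : V'.frobeniusTrace p = 0)
    (hgood : V.HasGoodReductionAtPrime p) (hap : V.frobeniusTrace p = 0)
    (hcong : ModPCongruent V' V p)
    (hμ' : ∀ (K₀ : Type) [Field K₀] [NumberField K₀] [IsCyclotomicExtension {p} ℚ K₀]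
        [(galRange (K := ℚ) K₀).Normal] (ηq : absoluteGaloisGroup ℚ →* ℤˣ),
        (∀ σ ∈ galRange (K := ℚ) K₀, ηq σ = 1) → ηq ≠ 1 →
      ∀ (κ : ZpExtension ℚ p) (γ : absoluteGaloisGroup ℚ),
        κ.IsCyclotomic → κ.IsTopGenerator γ → γ ∈ galRange (K := ℚ) K₀ →
      ∀ (D : EtaSignedSelmerDualData V' κ K₀ ℚ_[p] ηq γ 1) (g : IwasawaAlgebra p),
        D.charIdeal = Ideal.span {g} → HasUnitContent g) :
    ∀ (K₀ : Type) [Field K₀] [NumberField K₀] [IsCyclotomicExtension {p} ℚ K₀]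
        [(galRange (K := ℚ) K₀).Normal] (ηq : absoluteGaloisGroup ℚ →* ℤˣ),
        (∀ σ ∈ galRange (K := ℚ) K₀, ηq σ = 1) → ηq ≠ 1 →
      ∀ (κ : ZpExtension ℚ p) (γ : absoluteGaloisGroup ℚ),
        κ.IsCyclotomic → κ.IsTopGenerator γ → γ ∈ galRange (K := ℚ) K₀ →
      ∀ (D : EtaSignedSelmerDualData V κ K₀ ℚ_[p] ηq γ 1) (g : IwasawaAlgebra p),
        D.charIdeal = Ideal.span {g} → HasUnitContent g :=
  hHL V' V hp5 hgood' hap' hgood hap hcong hμ'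

/-- **The anchor discharged by a UNIT row.** If the anchor `V′` (good, `a_p(V′) = 0`, `V′[p] ≅ V[p]`)
has an additive partner `W′` (`C′ • W′^{(p*)} = V′`, globally minimal) with `Sel_{p^∞}(W′/ℚ) = 0` and
`p ∤ Tam(W′)`, then `μ = 0` holds for every `η`-datum of `V′` (seat g2:
`EtaMuBound.eta_hasUnitContent_of_selmer_trivial_of_not_dvd_tamagawa`, indeed `X⁺(V′/K_∞)^η = 0`), hence —
by the displayed transfer `hHL` — for every `η`-datum of `V`. Census: the 5 non-CM unit rows of 19606
have CM unit anchors (900b1, 3600bb1, 10800cj1, 14400cz1); the 7 Tamagawa rows have NONE below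
`5·10⁵` (their CM anchors 2700p1, 675a1, 14400l1 have analytic rank `1`). CONDITIONAL on `hHL`.
[cite: HatleyLei2019, Thm. 4.6] [cite: GreenbergLNM1716, §3 Prop. 3.8, §4 Lemma 4.2]
[cite: Kobayashi2003, §4 p. 8, Thm. 9.3 with (9.33)] -/
theorem etaMu_of_modPCongruent_unitRow
    (hHL : ∀ (V' : WeierstrassCurve ℚ) [V'.IsElliptic] [V'.IsGloballyMinimal]
        (V : WeierstrassCurve ℚ) [V.IsElliptic] [V.IsGloballyMinimal],
        5 ≤ p → V'.HasGoodReductionAtPrime p → V'.frobeniusTrace p = 0 →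
        V.HasGoodReductionAtPrime p → V.frobeniusTrace p = 0 → ModPCongruent V' V p →
      (∀ (K₀ : Type) [Field K₀] [NumberField K₀] [IsCyclotomicExtension {p} ℚ K₀]
          [(galRange (K := ℚ) K₀).Normal] (ηq : absoluteGaloisGroup ℚ →* ℤˣ),
          (∀ σ ∈ galRange (K := ℚ) K₀, ηq σ = 1) → ηq ≠ 1 →
        ∀ (κ : ZpExtension ℚ p) (γ : absoluteGaloisGroup ℚ),
          κ.IsCyclotomic → κ.IsTopGenerator γ → γ ∈ galRange (K := ℚ) K₀ →
        ∀ (D : EtaSignedSelmerDualData V' κ K₀ ℚ_[p] ηq γ 1) (g : IwasawaAlgebra p),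
          D.charIdeal = Ideal.span {g} → HasUnitContent g) →
      (∀ (K₀ : Type) [Field K₀] [NumberField K₀] [IsCyclotomicExtension {p} ℚ K₀]
          [(galRange (K := ℚ) K₀).Normal] (ηq : absoluteGaloisGroup ℚ →* ℤˣ),
          (∀ σ ∈ galRange (K := ℚ) K₀, ηq σ = 1) → ηq ≠ 1 →
        ∀ (κ : ZpExtension ℚ p) (γ : absoluteGaloisGroup ℚ),
          κ.IsCyclotomic → κ.IsTopGenerator γ → γ ∈ galRange (K := ℚ) K₀ →
        ∀ (D : EtaSignedSelmerDualData V κ K₀ ℚ_[p] ηq γ 1) (g : IwasawaAlgebra p),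
          D.charIdeal = Ideal.span {g} → HasUnitContent g))
    (V' : WeierstrassCurve ℚ) [V'.IsElliptic] [V'.IsGloballyMinimal]
    (W' : WeierstrassCurve ℚ) [W'.IsElliptic] [W'.IsGloballyMinimal] (C' : VariableChange ℚ)
    (V : WeierstrassCurve ℚ) [V.IsElliptic] [V.IsGloballyMinimal]
    (hp5 : 5 ≤ p) (hCV' : C' • W'.quadraticTwist ((-1) ^ (p / 2) * p) = V')
    (hgood' : V'.HasGoodReductionAtPrime p) (hap' : V'.frobeniusTrace p = 0)
    (hSel' : W'.selmerGroupPInfty p = ⊥) (hTam' : ¬ p ∣ W'.tamagawaProduct)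
    (hgood : V.HasGoodReductionAtPrime p) (hap : V.frobeniusTrace p = 0)
    (hcong : ModPCongruent V' V p) :
    ∀ (K₀ : Type) [Field K₀] [NumberField K₀] [IsCyclotomicExtension {p} ℚ K₀]
        [(galRange (K := ℚ) K₀).Normal] (ηq : absoluteGaloisGroup ℚ →* ℤˣ),
        (∀ σ ∈ galRange (K := ℚ) K₀, ηq σ = 1) → ηq ≠ 1 →
      ∀ (κ : ZpExtension ℚ p) (γ : absoluteGaloisGroup ℚ),
        κ.IsCyclotomic → κ.IsTopGenerator γ → γ ∈ galRange (K := ℚ) K₀ →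
      ∀ (D : EtaSignedSelmerDualData V κ K₀ ℚ_[p] ηq γ 1) (g : IwasawaAlgebra p),
        D.charIdeal = Ideal.span {g} → HasUnitContent g :=
  etaMu_of_modPCongruent p hHL V' V hp5 hgood' hap' hgood hap hcong
    (EtaMuBound.eta_hasUnitContent_of_selmer_trivial_of_not_dvd_tamagawa W' p V' C' hp5 hCV' hgood' hap'
      hSel' hTam')

/-! ## §2 Composed with the `μ`-road: (C1⁺_η)(V,p) on a rank-`0` row from a congruent anchor -/

/-- **(C1⁺_η)(V,p) at a Gss2 pair of analytic rank `0` FROM A CONGRUENT ANCHOR.** `W` globally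
minimal, `p ≥ 5`, `V` a globally minimal model of `W^{(p*)}` good at `p` with `a_p(V) = 0`, `L(W,1) ≠ 0`,
`Typed.MissingLowerBoundAt W p` (the lower half of `BSD_p(W)`, INPUT); an anchor `V′` (good,
`a_p(V′) = 0`, `V′[p] ≅ V[p]`) with `μ = 0` for every `η`-datum (`hμ′`, displayed); the transfer `hHL`
(Hatley–Lei Thm. 4.6 at `η`, displayed); named facts `hPT`, `hmod`, `hGZK`, `h22`, `h41`, `hKO`.
§1 + seat g2's `EtaMuSaturation.quadraticBranchPlusEtaMainConjectureAt_of_hasUnitContent_of_missingLowerBoundAt`.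
On the 7 Tamagawa-`5` rows of the census the anchors are the rank-one CM pairs (2700p1, 675a1,
14400l1 at `p = 5`, congruences certified by Kraus–Oesterlé Prop. 4), whose `hμ′` is the CM stub's
(Pollack–Rubin at `η` + one unit coefficient of `L_p⁺(V′,η,X)`). CONDITIONAL; nothing booked;
`BSD(W,p)` is an INPUT. [cite: HatleyLei2019, Thm. 4.6] [cite: Kobayashi2003, §4 Even main conjecture and Thm. 4.1 (p. 8)]
[cite: PollackRubin2004, Theorem and remark p. 448] [cite: Miller2011LMS, Def. 1.1] [cite: KrausOesterle1992, Prop. 4] -/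
theorem quadraticBranchPlusEtaMainConjectureAt_of_modPCongruent_of_missingLowerBoundAt
    (hHL : ∀ (V' : WeierstrassCurve ℚ) [V'.IsElliptic] [V'.IsGloballyMinimal]
        (V : WeierstrassCurve ℚ) [V.IsElliptic] [V.IsGloballyMinimal],
        5 ≤ p → V'.HasGoodReductionAtPrime p → V'.frobeniusTrace p = 0 →
        V.HasGoodReductionAtPrime p → V.frobeniusTrace p = 0 → ModPCongruent V' V p →
      (∀ (K₀ : Type) [Field K₀] [NumberField K₀] [IsCyclotomicExtension {p} ℚ K₀]
          [(galRange (K := ℚ) K₀).Normal] (ηq : absoluteGaloisGroup ℚ →* ℤˣ),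
          (∀ σ ∈ galRange (K := ℚ) K₀, ηq σ = 1) → ηq ≠ 1 →
        ∀ (κ : ZpExtension ℚ p) (γ : absoluteGaloisGroup ℚ),
          κ.IsCyclotomic → κ.IsTopGenerator γ → γ ∈ galRange (K := ℚ) K₀ →
        ∀ (D : EtaSignedSelmerDualData V' κ K₀ ℚ_[p] ηq γ 1) (g : IwasawaAlgebra p),
          D.charIdeal = Ideal.span {g} → HasUnitContent g) →
      (∀ (K₀ : Type) [Field K₀] [NumberField K₀] [IsCyclotomicExtension {p} ℚ K₀]
          [(galRange (K := ℚ) K₀).Normal] (ηq : absoluteGaloisGroup ℚ →* ℤˣ),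
          (∀ σ ∈ galRange (K := ℚ) K₀, ηq σ = 1) → ηq ≠ 1 →
        ∀ (κ : ZpExtension ℚ p) (γ : absoluteGaloisGroup ℚ),
          κ.IsCyclotomic → κ.IsTopGenerator γ → γ ∈ galRange (K := ℚ) K₀ →
        ∀ (D : EtaSignedSelmerDualData V κ K₀ ℚ_[p] ηq γ 1) (g : IwasawaAlgebra p),
          D.charIdeal = Ideal.span {g} → HasUnitContent g))
    (hPT : poitouTate_selmerStructure_duality_real ℚ) (hmod : hasEntireLFunction_rat)
    (hGZK : rank_eq_analyticRank_of_analyticRank_le_one)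
    (h22 : Kobayashi2003.thm22_etaSignedSelmerDual_finite_torsion)
    (h41 : Kobayashi2003.thm41_plusEtaCharIdeal_dvd)
    (hKO : KitajimaOtsuki2018.mainThm13_etaSignedSelmerDual_noFiniteSubmodule)
    (W : WeierstrassCurve ℚ) [W.IsElliptic] [W.IsGloballyMinimal]
    (V : WeierstrassCurve ℚ) [V.IsElliptic] [V.IsGloballyMinimal] (C : VariableChange ℚ)
    (hp5 : 5 ≤ p) (hCV : C • W.quadraticTwist ((-1) ^ (p / 2) * p) = V)
    (hgood : V.HasGoodReductionAtPrime p) (hap : V.frobeniusTrace p = 0)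
    (hLW : W.entireLFunction 1 ≠ 0) (hlow : MissingLowerBoundAt W p)
    (V' : WeierstrassCurve ℚ) [V'.IsElliptic] [V'.IsGloballyMinimal]
    (hgood' : V'.HasGoodReductionAtPrime p) (hap' : V'.frobeniusTrace p = 0)
    (hcong : ModPCongruent V' V p)
    (hμ' : ∀ (K₀ : Type) [Field K₀] [NumberField K₀] [IsCyclotomicExtension {p} ℚ K₀]
        [(galRange (K := ℚ) K₀).Normal] (ηq : absoluteGaloisGroup ℚ →* ℤˣ),
        (∀ σ ∈ galRange (K := ℚ) K₀, ηq σ = 1) → ηq ≠ 1 →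
      ∀ (κ : ZpExtension ℚ p) (γ : absoluteGaloisGroup ℚ),
        κ.IsCyclotomic → κ.IsTopGenerator γ → γ ∈ galRange (K := ℚ) K₀ →
      ∀ (D : EtaSignedSelmerDualData V' κ K₀ ℚ_[p] ηq γ 1) (g : IwasawaAlgebra p),
        D.charIdeal = Ideal.span {g} → HasUnitContent g) :
    QuadraticBranchPlusEtaMainConjectureAt V p :=
  EtaMuSaturation.quadraticBranchPlusEtaMainConjectureAt_of_hasUnitContent_of_missingLowerBoundAt W p hPT
    hmod hGZK h22 h41 hKO V C hp5 hCV hgood hap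
    (etaMu_of_modPCongruent p hHL V' V hp5 hgood' hap' hgood hap hcong hμ') hLW hlow

/-! ## §3 (appended) The INTEGRAL upper inclusion at `η` from a congruent anchor — no rank hypothesis -/

/-- **The integral Kato-side inclusion `(L_p⁺(V,η,X)) ⊆ Char(X⁺(V/K_∞)^η)` (`EtaUpperIntegralAt V p`, the
conclusion of `stub_etaMC_nonCM_upper` at `(V,p)`) FROM A CONGRUENT ANCHOR, on a row of ANY analytic
rank.** `V` globally minimal good at `p ≥ 5` with `a_p(V) = 0`; an anchor `V′` (good, `a_p(V′) = 0`,
`V′[p] ≅ V[p]`) with `μ = 0` for every `η`-datum (`hμ′`, displayed); the transfer `hHL` (Hatley–Lei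
Thm. 4.6 at `η`, displayed); named facts `h22` (Kobayashi Thm. 2.2 at `η`) and `h41` (the RATIONAL
clause of Thm. 4.1 at `η`). §1 + seat g2's `EtaMuSaturation.etaUpperIntegral_of_hasUnitContent`
(Gauss' lemma: `pⁿ·Lη ∈ (g)` and `p ∤ g` give `g ∣ Lη`). Census (kit j270654 + Kraus–Oesterlé
certificates j270714): 9 of the 16 non-CM RANK-ONE rows of 19606 below `5·10⁵` (104400dc1, 26100h1,
243900o1, 243900p1, 313200el1, 341775ca1, 341775dj1, 417600ke1, 458100j1) are congruent mod `5` to a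
CM UNIT row (3600bb1, 900b1, 10800cj1, 11025e1, 14400cz1) — there `hμ′` is seat g2's theorem
(`…_unitRow` below) and the upper stub's conclusion holds modulo `hHL`. CONDITIONAL; nothing booked.
[cite: HatleyLei2019, Thm. 4.6] [cite: Kobayashi2003, Thm. 4.1 first display (p. 8), Thm. 2.2 (p. 5)]
[cite: GreenbergVatsal2000, p. 2 (2)] [cite: Washington1997, §7.1] -/
theorem etaUpperIntegral_of_modPCongruent
    (hHL : ∀ (V' : WeierstrassCurve ℚ) [V'.IsElliptic] [V'.IsGloballyMinimal]
        (V : WeierstrassCurve ℚ) [V.IsElliptic] [V.IsGloballyMinimal],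
        5 ≤ p → V'.HasGoodReductionAtPrime p → V'.frobeniusTrace p = 0 →
        V.HasGoodReductionAtPrime p → V.frobeniusTrace p = 0 → ModPCongruent V' V p →
      (∀ (K₀ : Type) [Field K₀] [NumberField K₀] [IsCyclotomicExtension {p} ℚ K₀]
          [(galRange (K := ℚ) K₀).Normal] (ηq : absoluteGaloisGroup ℚ →* ℤˣ),
          (∀ σ ∈ galRange (K := ℚ) K₀, ηq σ = 1) → ηq ≠ 1 →
        ∀ (κ : ZpExtension ℚ p) (γ : absoluteGaloisGroup ℚ),
          κ.IsCyclotomic → κ.IsTopGenerator γ → γ ∈ galRange (K := ℚ) K₀ →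
        ∀ (D : EtaSignedSelmerDualData V' κ K₀ ℚ_[p] ηq γ 1) (g : IwasawaAlgebra p),
          D.charIdeal = Ideal.span {g} → HasUnitContent g) →
      (∀ (K₀ : Type) [Field K₀] [NumberField K₀] [IsCyclotomicExtension {p} ℚ K₀]
          [(galRange (K := ℚ) K₀).Normal] (ηq : absoluteGaloisGroup ℚ →* ℤˣ),
          (∀ σ ∈ galRange (K := ℚ) K₀, ηq σ = 1) → ηq ≠ 1 →
        ∀ (κ : ZpExtension ℚ p) (γ : absoluteGaloisGroup ℚ),
          κ.IsCyclotomic → κ.IsTopGenerator γ → γ ∈ galRange (K := ℚ) K₀ →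
        ∀ (D : EtaSignedSelmerDualData V κ K₀ ℚ_[p] ηq γ 1) (g : IwasawaAlgebra p),
          D.charIdeal = Ideal.span {g} → HasUnitContent g))
    (h22 : Kobayashi2003.thm22_etaSignedSelmerDual_finite_torsion)
    (h41 : Kobayashi2003.thm41_plusEtaCharIdeal_dvd)
    (V' : WeierstrassCurve ℚ) [V'.IsElliptic] [V'.IsGloballyMinimal]
    (V : WeierstrassCurve ℚ) [V.IsElliptic] [V.IsGloballyMinimal]
    (hp5 : 5 ≤ p) (hgood' : V'.HasGoodReductionAtPrime p) (hap' : V'.frobeniusTrace p = 0)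
    (hgood : V.HasGoodReductionAtPrime p) (hap : V.frobeniusTrace p = 0)
    (hcong : ModPCongruent V' V p)
    (hμ' : ∀ (K₀ : Type) [Field K₀] [NumberField K₀] [IsCyclotomicExtension {p} ℚ K₀]
        [(galRange (K := ℚ) K₀).Normal] (ηq : absoluteGaloisGroup ℚ →* ℤˣ),
        (∀ σ ∈ galRange (K := ℚ) K₀, ηq σ = 1) → ηq ≠ 1 →
      ∀ (κ : ZpExtension ℚ p) (γ : absoluteGaloisGroup ℚ),
        κ.IsCyclotomic → κ.IsTopGenerator γ → γ ∈ galRange (K := ℚ) K₀ →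
      ∀ (D : EtaSignedSelmerDualData V' κ K₀ ℚ_[p] ηq γ 1) (g : IwasawaAlgebra p),
        D.charIdeal = Ideal.span {g} → HasUnitContent g) :
    ∀ (K₀ : Type) [Field K₀] [NumberField K₀] [IsCyclotomicExtension {p} ℚ K₀]
        [(galRange (K := ℚ) K₀).Normal] (ηq : absoluteGaloisGroup ℚ →* ℤˣ),
        (∀ σ ∈ galRange (K := ℚ) K₀, ηq σ = 1) → ηq ≠ 1 →
      ∀ {N : ℕ} [NeZero N] {f : CuspForm (Gamma0 N) 2},
        p ≠ 2 → V.HasGoodReductionAtPrime p → V.frobeniusTrace p = 0 → IsNewformOf V f →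
      ∀ (ϖ : ℚ), (if Even (p / 2) then (ϖ : ℝ) * V.realPeriodRat = plusPeriod f
          else (ϖ : ℝ) * V.imaginaryPeriodRat = minusPeriod f) →
      ∀ (Lη : IwasawaAlgebra p), IsQuadraticBranchPlusLFunction f p ϖ Lη →
      ∀ (κ : ZpExtension ℚ p) (γ : absoluteGaloisGroup ℚ),
        κ.IsCyclotomic → κ.IsTopGenerator γ → γ ∈ galRange (K := ℚ) K₀ → IsCyclotomicVariable p γ →
      ∀ (D : EtaSignedSelmerDualData V κ K₀ ℚ_[p] ηq γ 1), Ideal.span {Lη} ≤ D.charIdeal :=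
  EtaMuSaturation.etaUpperIntegral_of_hasUnitContent V p h22 h41
    (etaMu_of_modPCongruent p hHL V' V hp5 hgood' hap' hgood hap hcong hμ')

/-- **The integral upper inclusion at `η` from a congruent UNIT-row anchor** (any rank at `V`): the
anchor `V′` has an additive partner `W′` (`C′ • W′^{(p*)} = V′`) with `Sel_{p^∞}(W′/ℚ) = 0` and
`p ∤ Tam(W′)` — so `X⁺(V′/K_∞)^η = 0`, `μ = 0` (seat g2); `hHL` transports `μ = 0` to `V`, and Gauss'
lemma turns Thm. 4.1's `pⁿ` into the integral inclusion. The shape of the 9 rank-one census rows above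
(anchors = CM unit rows). CONDITIONAL on `hHL`, `h22`, `h41`; nothing booked.
[cite: HatleyLei2019, Thm. 4.6] [cite: Kobayashi2003, Thm. 4.1 (p. 8)] [cite: GreenbergLNM1716, §3 Prop. 3.8] -/
theorem etaUpperIntegral_of_modPCongruent_unitRow
    (hHL : ∀ (V' : WeierstrassCurve ℚ) [V'.IsElliptic] [V'.IsGloballyMinimal]
        (V : WeierstrassCurve ℚ) [V.IsElliptic] [V.IsGloballyMinimal],
        5 ≤ p → V'.HasGoodReductionAtPrime p → V'.frobeniusTrace p = 0 →
        V.HasGoodReductionAtPrime p → V.frobeniusTrace p = 0 → ModPCongruent V' V p →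
      (∀ (K₀ : Type) [Field K₀] [NumberField K₀] [IsCyclotomicExtension {p} ℚ K₀]
          [(galRange (K := ℚ) K₀).Normal] (ηq : absoluteGaloisGroup ℚ →* ℤˣ),
          (∀ σ ∈ galRange (K := ℚ) K₀, ηq σ = 1) → ηq ≠ 1 →
        ∀ (κ : ZpExtension ℚ p) (γ : absoluteGaloisGroup ℚ),
          κ.IsCyclotomic → κ.IsTopGenerator γ → γ ∈ galRange (K := ℚ) K₀ →
        ∀ (D : EtaSignedSelmerDualData V' κ K₀ ℚ_[p] ηq γ 1) (g : IwasawaAlgebra p),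
          D.charIdeal = Ideal.span {g} → HasUnitContent g) →
      (∀ (K₀ : Type) [Field K₀] [NumberField K₀] [IsCyclotomicExtension {p} ℚ K₀]
          [(galRange (K := ℚ) K₀).Normal] (ηq : absoluteGaloisGroup ℚ →* ℤˣ),
          (∀ σ ∈ galRange (K := ℚ) K₀, ηq σ = 1) → ηq ≠ 1 →
        ∀ (κ : ZpExtension ℚ p) (γ : absoluteGaloisGroup ℚ),
          κ.IsCyclotomic → κ.IsTopGenerator γ → γ ∈ galRange (K := ℚ) K₀ →
        ∀ (D : EtaSignedSelmerDualData V κ K₀ ℚ_[p] ηq γ 1) (g : IwasawaAlgebra p),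
          D.charIdeal = Ideal.span {g} → HasUnitContent g))
    (h22 : Kobayashi2003.thm22_etaSignedSelmerDual_finite_torsion)
    (h41 : Kobayashi2003.thm41_plusEtaCharIdeal_dvd)
    (V' : WeierstrassCurve ℚ) [V'.IsElliptic] [V'.IsGloballyMinimal]
    (W' : WeierstrassCurve ℚ) [W'.IsElliptic] [W'.IsGloballyMinimal] (C' : VariableChange ℚ)
    (V : WeierstrassCurve ℚ) [V.IsElliptic] [V.IsGloballyMinimal]
    (hp5 : 5 ≤ p) (hCV' : C' • W'.quadraticTwist ((-1) ^ (p / 2) * p) = V')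
    (hgood' : V'.HasGoodReductionAtPrime p) (hap' : V'.frobeniusTrace p = 0)
    (hSel' : W'.selmerGroupPInfty p = ⊥) (hTam' : ¬ p ∣ W'.tamagawaProduct)
    (hgood : V.HasGoodReductionAtPrime p) (hap : V.frobeniusTrace p = 0)
    (hcong : ModPCongruent V' V p) :
    ∀ (K₀ : Type) [Field K₀] [NumberField K₀] [IsCyclotomicExtension {p} ℚ K₀]
        [(galRange (K := ℚ) K₀).Normal] (ηq : absoluteGaloisGroup ℚ →* ℤˣ),
        (∀ σ ∈ galRange (K := ℚ) K₀, ηq σ = 1) → ηq ≠ 1 →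
      ∀ {N : ℕ} [NeZero N] {f : CuspForm (Gamma0 N) 2},
        p ≠ 2 → V.HasGoodReductionAtPrime p → V.frobeniusTrace p = 0 → IsNewformOf V f →
      ∀ (ϖ : ℚ), (if Even (p / 2) then (ϖ : ℝ) * V.realPeriodRat = plusPeriod f
          else (ϖ : ℝ) * V.imaginaryPeriodRat = minusPeriod f) →
      ∀ (Lη : IwasawaAlgebra p), IsQuadraticBranchPlusLFunction f p ϖ Lη →
      ∀ (κ : ZpExtension ℚ p) (γ : absoluteGaloisGroup ℚ),
        κ.IsCyclotomic → κ.IsTopGenerator γ → γ ∈ galRange (K := ℚ) K₀ → IsCyclotomicVariable p γ →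
      ∀ (D : EtaSignedSelmerDualData V κ K₀ ℚ_[p] ηq γ 1), Ideal.span {Lη} ≤ D.charIdeal :=
  etaUpperIntegral_of_modPCongruent p hHL h22 h41 V' V hp5 hgood' hap' hgood hap hcong
    (EtaMuBound.eta_hasUnitContent_of_selmer_trivial_of_not_dvd_tamagawa W' p V' C' hp5 hCV' hgood' hap'
      hSel' hTam')

end EtaCongruentAnchor

end Summit.BirchSwinnertonDyer.BirchSwinnertonDyer.Theorems

end
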